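import Summits.BirchSwinnertonDyer.BirchSwinnertonDyer.Theses.GoldfeldAllTwistsTwoConverse
import Summits.BirchSwinnertonDyer.BirchSwinnertonDyer.Theorems.GoldfeldAllTwistsTwoConverseTwinAdditiveHeegnerIndex
import HarnessLib

set_option linter.dupNamespace false
set_option autoImplicit false

/-!
# Crux twin″ = `BSDTwoCMSevenAdditiveRankOne` (item stmt-BirchSwinnertonDyer-19140) —
# line «heegner-halves» v2 — the REGISTERED skeleton a20572d66ae139e2 with the halves RESHAPED to carry the
# published binders (proposal of leafhand-bsd-goldfeldalltwistst-2-g0, 2026-08-30; NOT registered)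

WHY v2 (diagnosis, leafhand-2-g0). In the registered skeleton the two halves
`stub_heegnerIndexUpperAtTwo` / `stub_heegnerIndexLowerAtTwo` carry NO published binder, while the
identity they split (`P2.bsdp_two_iff_cmHeegnerIndex`) is only meaningful GRANTED Gross–Zagier,
Kolyvagin, GZK, modularity and Burungale–Flach: without them Lean cannot exclude the formal branches
«`P` torsion» (`(AddSubgroup.zmultiples P).index` junk, `𝔮 = 0` or unrelated), «`Ш(W)` infinite»
(`Nat.card W.sha = 0`, `padicValNat 2 0 = 0`) and «`Wd(ℚ)` or `Ш(Wd)` infinite» (`twinQuotient Wd = 0`,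
`𝔮 = 0`). In those branches the registered upper half reads `ord₂ #Ш(W) ≤ 0` and the lower half
`ord₂ 𝔮 ≤ 0` — statements a stub worker can neither prove nor refute without re-proving the
non-degeneracy clause of Gross–Zagier (`ĥ(P) ≠ 0`) and Kolyvagin's finiteness INSIDE the stub. So each
registered half = (its genuinely new `2`-adic content) + (Gross–Zagier–Kolyvagin for the datum, from
scratch): mis-sized. v2 prefixes the five binders of `P2.bsdp_two_iff_cmHeegnerIndex` to both halves;
stub (3) already supplies them, so the composition is unchanged and still kernel-checked. Under the
binders the worker gets `Finite W.sha ∧ Finite Wd(ℚ) ∧ Finite Ш(Wd)` and the pinned halvability bit from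
`P2.shaAn_eq_cmHeegnerIndexFormula_two`, and each half is exactly the open `2`-adic statement
(Euler-system half / exact-`2`-divisibility half) modulo print.

LINE: cell bsd-cm's `L`-FREE reformulation of the CM rank-one corner at `2`
(`P2.bsdp_two_iff_cmHeegnerIndex`): granted Gross–Zagier, Kolyvagin, GZK, modularity and
Burungale–Flach for the rank-zero twin, `BSD(E,2) ⟺ ord₂ 𝔮 = ord₂ #Ш(E)` with
`𝔮 = cmHeegnerIndexQuotient …`. The identity is split into its two halves (stubs 1–2, both NOT in
print: Li–Tian–Yan–Zhu 2025 §1.3 (II)); the eight published binders of the consumer are stub 3.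
Composition `BSDTwoCMSevenAdditiveRankOne_of` is kernel-checked; sorries ONLY in `stub_*`.
-/

namespace Summit.BirchSwinnertonDyer.BirchSwinnertonDyer.Cruxes.BSDTwoCMSevenAdditiveRankOne.HeegnerHalvesV2

noncomputable section

open scoped Classical

open WeierstrassCurve NumberField Literature.NumberTheory.EllipticCurves
  Literature.NumberTheory.EllipticCurves.ModularForms
  Literature.NumberTheory.EllipticCurves.Rank1Residual
open Summit.BirchSwinnertonDyer.Rank1Residual.P2
open Summit.BirchSwinnertonDyer.BirchSwinnertonDyer.Theorems.GoldfeldGoodTwists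

/-- stub (1) v2 [XL; Euler-system half — NOT in print at additive `2`]: GRANTED the five published binders of
`P2.bsdp_two_iff_cmHeegnerIndex` (Gross–Zagier, Kolyvagin, GZK, modularity, Burungale–Flach),
`ord₂ #Ш(E) ≤ ord₂ 𝔮` on the cell. -/
theorem stub_heegnerIndexUpperAtTwo :
    (∀ (N : ℕ) [NeZero N] (W : WeierstrassCurve ℚ) (K : Type) [Field K] [NumberField K], gross_zagier N W K) →
    (∀ (N : ℕ) [NeZero N] (W : WeierstrassCurve ℚ) (K : Type) [Field K] [NumberField K], kolyvagin N W K) →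
    rank_eq_analyticRank_of_analyticRank_le_one → hasEntireLFunction_rat →
    bsdTriple_of_hasCM_of_L_one_ne_zero →
    ∀ (W : WeierstrassCurve ℚ) [W.IsElliptic] [W.IsGloballyMinimal] (N : ℕ) [NeZero N] (K : Type) [Field K]
      [NumberField K] (Dt : ModularParametrizationData W N) (H : HeegnerDatum N (NumberField.discr K))
      (ι : K →+* ℂ) (P : (W.baseChange K).toAffine.Point) (Wd : WeierstrassCurve ℚ) [Wd.IsElliptic]
      [Wd.IsGloballyMinimal] (Cd : VariableChange ℚ) (k : ℕ), W.HasCM → CMSplit W 2 →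
      ¬ W.HasGoodReductionAtPrime 2 → W.analyticRank = 1 → IsImaginaryQuadratic K →
      SatisfiesHeegnerHypothesis N K →
      WeierstrassCurve.Affine.Point.map ι.toRatAlgHom P = heegnerPointComplex Dt H →
      (W.quadraticTwist (NumberField.discr K : ℚ)).entireLFunction 1 ≠ 0 →
      Cd • W.quadraticTwist (NumberField.discr K : ℚ) = Wd → (k = 1 ∨ k = 2) →
      (k = 2 ↔ ∀ y : W.toAffine.Point, ∃ Q : (W.baseChange K).toAffine.Point,
        QuadraticDescent.incl K W y - (2 : ℤ) • Q ∈ AddCommGroup.torsion (W.baseChange K).toAffine.Point) →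
      (padicValNat 2 (Nat.card W.sha) : ℤ) ≤ padicValRat 2 (cmHeegnerIndexQuotient W K P Dt.c k Wd Cd.u) := by
  sorry

/-- stub (2) v2 [XL; main-conjecture / exact-`2`-divisibility half — NOT in print at additive `2`]: GRANTED the
same five binders, `ord₂ 𝔮 ≤ ord₂ #Ш(E)` on the cell. -/
theorem stub_heegnerIndexLowerAtTwo :
    (∀ (N : ℕ) [NeZero N] (W : WeierstrassCurve ℚ) (K : Type) [Field K] [NumberField K], gross_zagier N W K) →
    (∀ (N : ℕ) [NeZero N] (W : WeierstrassCurve ℚ) (K : Type) [Field K] [NumberField K], kolyvagin N W K) →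
    rank_eq_analyticRank_of_analyticRank_le_one → hasEntireLFunction_rat →
    bsdTriple_of_hasCM_of_L_one_ne_zero →
    ∀ (W : WeierstrassCurve ℚ) [W.IsElliptic] [W.IsGloballyMinimal] (N : ℕ) [NeZero N] (K : Type) [Field K]
      [NumberField K] (Dt : ModularParametrizationData W N) (H : HeegnerDatum N (NumberField.discr K))
      (ι : K →+* ℂ) (P : (W.baseChange K).toAffine.Point) (Wd : WeierstrassCurve ℚ) [Wd.IsElliptic]
      [Wd.IsGloballyMinimal] (Cd : VariableChange ℚ) (k : ℕ), W.HasCM → CMSplit W 2 →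
      ¬ W.HasGoodReductionAtPrime 2 → W.analyticRank = 1 → IsImaginaryQuadratic K →
      SatisfiesHeegnerHypothesis N K →
      WeierstrassCurve.Affine.Point.map ι.toRatAlgHom P = heegnerPointComplex Dt H →
      (W.quadraticTwist (NumberField.discr K : ℚ)).entireLFunction 1 ≠ 0 →
      Cd • W.quadraticTwist (NumberField.discr K : ℚ) = Wd → (k = 1 ∨ k = 2) →
      (k = 2 ↔ ∀ y : W.toAffine.Point, ∃ Q : (W.baseChange K).toAffine.Point,
        QuadraticDescent.incl K W y - (2 : ℤ) • Q ∈ AddCommGroup.torsion (W.baseChange K).toAffine.Point) →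
      padicValRat 2 (cmHeegnerIndexQuotient W K P Dt.c k Wd Cd.u) ≤ padicValNat 2 (Nat.card W.sha) := by
  sorry

/-- stub (3) [print; the eight published binders of the consumer, BY NAME — each a cite-tagged Literature
`Prop` whose `_holds` waits on the Modularity Theorem / Gross–Zagier / Kolyvagin / Burungale–Flach]. -/
theorem stub_publishedFactsTwinAtTwo :
    (∀ (N : ℕ) [NeZero N] (W : WeierstrassCurve ℚ) (K : Type) [Field K] [NumberField K], gross_zagier N W K) ∧
    (∀ (N : ℕ) [NeZero N] (W : WeierstrassCurve ℚ) (K : Type) [Field K] [NumberField K], kolyvagin N W K) ∧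
    rank_eq_analyticRank_of_analyticRank_le_one ∧ hasEntireLFunction_rat ∧
    bsdTriple_of_hasCM_of_L_one_ne_zero ∧ waldspurger_exists_heegnerField_twist_ne_zero ∧
    (∀ W : WeierstrassCurve ℚ, W.even_analyticRank_iff) ∧
    (∀ (W : WeierstrassCurve ℚ) (K : Type) [Field K] [NumberField K], exists_isHeegnerPoint W K) := by
  sorry

/-- **Composition (kernel-checked):** stubs (1)–(3) ⟹ the crux twin″, BY NAME — the two halves give the
`L`-free identity `CMSevenAdditiveHeegnerIndexAtTwo` (`le_antisymm`), and the landed consumer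
`bsdTwoCMSevenAdditiveRankOne_of_heegnerIndexAtTwo` fed with the eight binders of stub (3) concludes; the
five binders of the halves are the first five conjuncts of stub (3). -/
theorem BSDTwoCMSevenAdditiveRankOne_of :
    Summit.BirchSwinnertonDyer.BirchSwinnertonDyer.Theses.GoldfeldAllTwistsTwoConverse.BSDTwoCMSevenAdditiveRankOne := by
  obtain ⟨hGZ, hKo, hGZK, hmod, hBF, hWa, hpar, hHP⟩ := stub_publishedFactsTwinAtTwo
  refine bsdTwoCMSevenAdditiveRankOne_of_heegnerIndexAtTwo hGZ hKo hGZK hmod hBF hWa hpar hHP ?_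
  intro W _ _ N _ K _ _ Dt H ι P Wd _ _ Cd k hcm hsplit hbad hr hK hHN hP hLt hWd hk12 hkiff
  exact le_antisymm
    (stub_heegnerIndexLowerAtTwo hGZ hKo hGZK hmod hBF W N K Dt H ι P Wd Cd k hcm hsplit hbad hr hK hHN hP
      hLt hWd hk12 hkiff)
    (stub_heegnerIndexUpperAtTwo hGZ hKo hGZK hmod hBF W N K Dt H ι P Wd Cd k hcm hsplit hbad hr hK hHN hP
      hLt hWd hk12 hkiff)

end

end Summit.BirchSwinnertonDyer.BirchSwinnertonDyer.Cruxes.BSDTwoCMSevenAdditiveRankOne.HeegnerHalvesV2
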